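import Mathlib.MeasureTheory.Group.Measure
import Mathlib.MeasureTheory.Measure.Prod
import HarnessLib

/-!
# Averaging over translates: a set whose sections along a family of right translates are null is null

Topic `MeasureTheory/Group`; namespace `Literature.MeasureTheory.Group`.  Theorems only (no definition, no named fact, no instance,
no `sorry`); Mathlib only.

**The averaging lemma.**  `G` a measurable group, `ν` an s-finite RIGHT-invariant measure on `G`, `(A, μ)` any s-finite measure space with
`μ ≠ 0` (typically a closed subgroup — a torus — with its Haar measure) and `φ : A → G` measurable.  If a measurable `S ⊆ G` meets
every «line» `{g · φ(a)}_a` in a `μ`-null set of parameters — `μ {a | g · φ(a) ∈ S} = 0` for all `g` — then `ν S = 0`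
(`measure_eq_zero_of_forall_measure_setOf_mul_mem_eq_zero`).  PROOF (Fubini both ways on `E = {(g, a) | g · φ(a) ∈ S} ⊆ G × A`):
the `g`-sections are null by hypothesis, so `(ν ⊗ μ) E = 0`; the `a`-sections are the right translates `S · φ(a)⁻¹`, of measure `ν S`,
so `(ν ⊗ μ) E = ν S · μ(A)`; in `ℝ≥0∞`, `ν S · μ A = 0` with `μ A ≠ 0` forces `ν S = 0` (no finiteness of `ν S` or `μ A` is needed).
Corollary for atomless `μ`: FINITE sections suffice (`measure_eq_zero_of_forall_finite_setOf_mul_mem`).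

WHY (the use).  This is the measure-theoretic half of «the non-regular set of a reductive p-adic group is Haar-null» as used in the
Weyl integration formula [HarishChandra1970, Lemma 42]: the singular set is cut out by polynomial equations, and along a
split torus `a ↦ g · t(a)` each equation has finitely many solutions, the torus Haar measure being atomless.  In the tree it discharges
the conullity hypothesis `νH {a | IsLocalGRegular L v a}ᶜ = 0` of ★ `integral_eq_zero_of_forall_classOrbitalIntegral_eq_zero_of_conull`
(P3b line, stub `stub_weylVanishingSplit`).

## References
* [HarishChandra1970] Harish-Chandra (notes by G. van Dijk), *Harmonic analysis on reductive p-adic groups*, LNM 162 (1970),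
  Lemma 42 (the regular set is open, dense, conull; Weyl integration formula).
* [WeilIntegration1965] A. Weil, *L'intégration dans les groupes topologiques et ses applications*, 2e éd. (1965), §9 (invariant measures,
  Fubini on `G × H`).
-/

set_option autoImplicit false

noncomputable section

open MeasureTheory Measure Set
open scoped ENNReal

namespace Literature.MeasureTheory.Group

variable {G : Type*} [Group G] [MeasurableSpace G] [MeasurableMul₂ G] {A : Type*} [MeasurableSpace A]

/-- **Averaging lemma.**  `ν` right-invariant and s-finite on `G`, `μ ≠ 0` s-finite on `A`, `φ : A → G` measurable, `S` measurable:
if `μ {a | g · φ a ∈ S} = 0` for every `g`, then `ν S = 0` (Fubini on `{(g, a) | g · φ a ∈ S}`; the `a`-sections are right translates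
of `S`). [cite: HarishChandra1970, Lemma 42] [cite: WeilIntegration1965, §9] -/
theorem measure_eq_zero_of_forall_measure_setOf_mul_mem_eq_zero (ν : Measure G) [SFinite ν] [ν.IsMulRightInvariant]
    (μ : Measure A) [SFinite μ] (hμ : μ ≠ 0) {φ : A → G} (hφ : Measurable φ) {S : Set G} (hS : MeasurableSet S)
    (h : ∀ g : G, μ {a | g * φ a ∈ S} = 0) : ν S = 0 := by
  set E : Set (G × A) := {p | p.1 * φ p.2 ∈ S} with hE_def
  have hE : MeasurableSet E := hS.preimage (measurable_fst.mul (hφ.comp measurable_snd))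
  have h1 : ν.prod μ E = 0 := by
    rw [Measure.prod_apply hE]
    have hsec : ∀ g : G, μ (Prod.mk g ⁻¹' E) = 0 := fun g => h g
    simp_rw [hsec, lintegral_zero]
  have h2 : ν.prod μ E = ν S * μ univ := by
    rw [Measure.prod_apply_symm hE]
    have hsec : ∀ a : A, ν ((fun g : G => (g, a)) ⁻¹' E) = ν S := fun a => measure_preimage_mul_right ν (φ a) S
    simp_rw [hsec, lintegral_const]
  rw [h1] at h2
  exact ((mul_eq_zero.mp h2.symm).resolve_right (Measure.measure_univ_ne_zero.mpr hμ))

/-- **Averaging lemma, finite-section form.**  With `μ` atomless, it suffices that every section `{a | g · φ a ∈ S}` is FINITE.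
[cite: HarishChandra1970, Lemma 42] [cite: WeilIntegration1965, §9] -/
theorem measure_eq_zero_of_forall_finite_setOf_mul_mem (ν : Measure G) [SFinite ν] [ν.IsMulRightInvariant]
    (μ : Measure A) [SFinite μ] [NullSingletonClass μ] (hμ : μ ≠ 0) {φ : A → G} (hφ : Measurable φ) {S : Set G} (hS : MeasurableSet S)
    (h : ∀ g : G, {a | g * φ a ∈ S}.Finite) : ν S = 0 :=
  measure_eq_zero_of_forall_measure_setOf_mul_mem_eq_zero ν μ hμ hφ hS fun g => (h g).measure_zero μ

/-- **Averaging lemma, covering form.**  If `S ⊆ ⋃_i S_i` (countably many measurable pieces) and each piece has finite sections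
along its own measurable family `φ_i : A_i → G` for an atomless `μ_i ≠ 0`, then `ν S = 0` — `S` itself need not be measurable.
[cite: HarishChandra1970, Lemma 42] [cite: WeilIntegration1965, §9] -/
theorem measure_eq_zero_of_subset_iUnion_of_forall_finite_setOf_mul_mem {ι : Type*} [Countable ι] (ν : Measure G) [SFinite ν]
    [ν.IsMulRightInvariant] {B : ι → Type*} [∀ i, MeasurableSpace (B i)] (μ : ∀ i, Measure (B i)) [∀ i, SFinite (μ i)]
    [∀ i, NullSingletonClass (μ i)] (hμ : ∀ i, μ i ≠ 0) (φ : ∀ i, B i → G) (hφ : ∀ i, Measurable (φ i)) {S : Set G} (T : ι → Set G)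
    (hT : ∀ i, MeasurableSet (T i)) (hST : S ⊆ ⋃ i, T i) (h : ∀ i (g : G), {a | g * φ i a ∈ T i}.Finite) : ν S = 0 :=
  measure_mono_null hST ((measure_iUnion_null_iff).mpr fun i =>
    measure_eq_zero_of_forall_finite_setOf_mul_mem ν (μ i) (hμ i) (hφ i) (hT i) (h i))

end Literature.MeasureTheory.Group

end
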